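import Mathlib.Data.Matrix.Basis
import Mathlib.Data.Matrix.Mul
import Literature.Computability.AlgebraicComplexity.BorderSubstitutionTorus
import HarnessLib

/-!
# Landsberg–Michałek 2018, §3 Part 1, for the algebraic border rank: `bR(M^λ) ≤ bR(M) − |λ|` — proved

Topic `Literature/Computability/AlgebraicComplexity`.  Theorems only (plus the data definition
`zeroSlices`).  For the matrix multiplication tensor `t₀ = ⟨n, w, n⟩ = matMulTensor K n w n`
(first factor `K^{n × n} ∋ e_{(κ,ν)}`, Landsberg–Michałek's `A = U* ⊗ V`) and a set `λ` of cells
`(κ, ν)`, write `t₀^λ = zeroSlices λ t₀` for `t₀` with the first-factor slices in `λ` zeroed, i.e.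
LM's `M_{⟨n,n,w⟩}/U_λ ∈ (A/U_λ) ⊗ B ⊗ C` in the coordinates `e_{(κ,ν)}, (κ,ν) ∉ λ`.  A *Young
diagram* here is a set of cells closed towards the corner `(n−1, 0)`:
`(κ,ν) ∈ λ, κ ≤ κ', ν' ≤ ν ⇒ (κ',ν') ∈ λ` (stated inline, no definition).

* `matMulTensor_stabilizer` — `(P̂ ⊗ P̌) ⊗ (Q̂ ⊗ 1) ⊗ (1 ⊗ Ř)` fixes `⟨n,w,n⟩` when
  `P̂ Q̂ᵀ = 1 = P̌ Řᵀ` (the `GL(U) × GL(V)`-symmetry, in the `restrict` format of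
  `BorderRankRestriction.lean`).
* `zeroSlices_stabilizer` — a stabilizer element whose first matrix preserves `U_λ` induces one
  of `t^λ`.
* `matMul_zeroSlices_step` — **LM §3 Part 1, inductive step**: for a Young diagram `λ'` with
  `|λ'| < n²` (and `w ≥ 1`) there is an addable cell `β` (so `λ' ∪ {β}` is again a Young diagram) with
  `bR(t₀^{λ' ∪ {β}}) + 1 ≤ bR(t₀^{λ'})`.  Printed proof: "Again by Proposition 2.3 there exists
  `a ∈ 𝔅_{R̲−k}(M^{λ'})` such that when we reduce by it the border rank drops … By the torus
  action and Lemma 2.2 we may assume that `a` has just one nonzero entry outside of `λ`. Further,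
  using the Borel action we can move the entry south-west to obtain the desired Young diagram."
  Here: take an optimal decomposition of `t₀^{λ'}`, the leading coefficient vector `lc` of a
  non-zero first-factor vector, its weight-minimal cell `α` (weights `(n−1−κ)n + ν`), an addable
  cell `β` south-west of `α`, the unipotent `GL(U) × GL(V)` element `e_α ↦ e_α + … + e_β`, and
  apply `algBorderRank_zeroSlice_le` (`BorderSubstitutionTorus.lean`: group action, torus
  degeneration `ε = δ^q`, one-step substitution — all inside `K[ε]`).
* `matMul_exists_youngDiagram_algBorderRank_le` — **LM §3 Part 1**: for every `k ≤ n²` there is a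
  Young diagram `λ` with `k` cells and `bR(t₀^λ) + k ≤ bR(⟨n,w,n⟩)`.

## References

* J. M. Landsberg, M. Michałek, *A `2n² − log₂(n) − 1` lower bound for the border rank of matrix
  multiplication*, IMRN 2018 (15) 4722–4733, arXiv:1608.07486 — §3, Part 1 (and Prop. 2.3,
  Lemma 2.2). [LandsbergMichalek2018]
-/

noncomputable section

open scoped BigOperators Polynomial
open Polynomial

namespace Literature.Computability.AlgebraicComplexity

universe u v₁ v₂ v₃

variable {K : Type u} [Field K]

/-! ## Zeroing a set of slices of the first factor -/

section ZeroSlices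

variable {ι : Type v₁} {κ : Type v₂} {μ : Type v₃}

/-- `t` with the first-factor slices `a ∈ S` replaced by `0`: the image of `t` in
`(A/U_S) ⊗ B ⊗ C`, `U_S = span{e_a : a ∈ S}`, in the coordinates `e_a, a ∉ S`, padded by zero
slices (Landsberg–Michałek's `T/U_λ`, `M^λ_{⟨n,n,w⟩} := M_{⟨n,n,w⟩}/U_λ`).
[cite: LandsbergMichalek2018, Def. 2.1 and §3 (U_λ, M^λ)] -/
def zeroSlices [DecidableEq ι] (S : Finset ι) (t : ι → κ → μ → K) : ι → κ → μ → K :=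
  fun a b c => if a ∈ S then 0 else t a b c

/-- Unfolding lemma for `zeroSlices`. [cite: LandsbergMichalek2018, Def. 2.1] -/
@[simp] theorem zeroSlices_apply [DecidableEq ι] (S : Finset ι) (t : ι → κ → μ → K) (a : ι) (b : κ)
    (c : μ) : zeroSlices S t a b c = if a ∈ S then 0 else t a b c := rfl

/-- Zeroing no slice. [cite: LandsbergMichalek2018, Def. 2.1] -/
theorem zeroSlices_empty [DecidableEq ι] (t : ι → κ → μ → K) : zeroSlices ∅ t = t := by
  funext a b c
  simp

/-- Zeroing one more slice. [cite: LandsbergMichalek2018, Def. 2.1] -/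
theorem zeroSlice_zeroSlices [DecidableEq ι] (S : Finset ι) (t : ι → κ → μ → K) (β : ι) :
    zeroSlice (zeroSlices S t) β = zeroSlices (insert β S) t := by
  funext a b c
  simp only [zeroSlice_apply, zeroSlices_apply, Finset.mem_insert]
  by_cases h1 : a = β <;> by_cases h2 : a ∈ S <;> simp [h1, h2]

/-- Zeroing the `S`-coordinates of the first vectors of an approximate decomposition of `t^S`
keeps it an approximate decomposition of `t^S` (those coordinates only see zero slices).
[cite: LandsbergMichalek2018, §3 Part 1] -/
theorem IsApproxDecomposition.zeroOn [DecidableEq ι] {S : Finset ι} {h : ℕ} {t : ι → κ → μ → K}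
    {r : ℕ} {u : Fin r → ι → K[X]} {v : Fin r → κ → K[X]} {w : Fin r → μ → K[X]}
    (H : IsApproxDecomposition h (zeroSlices S t) u v w) :
    IsApproxDecomposition h (zeroSlices S t) (fun ρ a => if a ∈ S then 0 else u ρ a) v w := by
  intro a b c j hj
  by_cases ha : a ∈ S
  · simp only [if_pos ha, zero_mul, Finset.sum_const_zero, coeff_zero, zeroSlices_apply]
    split_ifs <;> rfl
  · simp only [if_neg ha]
    exact H a b c j hj

/-- A stabilizer element `(A, B, C)` of `t` whose first matrix preserves `U_S = span{e_a : a ∈ S}`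
(`A_{a'a} = 0` for `a ∈ S`, `a' ∉ S`) induces the stabilizer element `(Ā, B, C)` of `t^S`,
`Ā = π_S A π_S` the induced map of `A/U_S` in the coordinates `e_a, a ∉ S` ("the product of Borel
groups that stabilize the flags induced by `λ'` stabilizes `M^{λ'}`").
[cite: LandsbergMichalek2018, §3 Part 1] -/
theorem zeroSlices_stabilizer [Fintype ι] [DecidableEq ι] [Fintype κ] [Fintype μ] (S : Finset ι)
    (t : ι → κ → μ → K) (A : ι → ι → K) (B : κ → κ → K) (Cm : μ → μ → K)
    (hstab : ∀ a' b' c', ∑ a, ∑ b, ∑ c, A a' a * B b' b * Cm c' c * t a b c = t a' b' c')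
    (hA : ∀ a' a, a ∈ S → a' ∉ S → A a' a = 0) (a' : ι) (b' : κ) (c' : μ) :
    ∑ a, ∑ b, ∑ c, (if a' ∈ S ∨ a ∈ S then 0 else A a' a) * B b' b * Cm c' c *
      zeroSlices S t a b c = zeroSlices S t a' b' c' := by
  by_cases ha' : a' ∈ S
  · simp [ha']
  · rw [zeroSlices_apply, if_neg ha', ← hstab a' b' c']
    refine Finset.sum_congr rfl fun a _ => ?_
    by_cases ha : a ∈ S
    · simp [ha, hA a' a ha ha']
    · simp [ha, ha']

end ZeroSlices

/-! ## The `GL(U) × GL(V)` symmetry of `⟨n, w, n⟩` -/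

section Symmetry

variable (K)

/-- Contracting against `⟨n,w,n⟩`: `∑_{b,c} F(b,c) ⟨n,w,n⟩_{a b c} = ∑_μ F((κ,μ),(μ,ν))` for
`a = (κ, ν)`. [cite: Blaser2013, §5 (the tensor ⟨k,m,n⟩)] -/
theorem sum_sum_mul_matMulTensor (n w : ℕ) (a : Fin n × Fin n)
    (F : Fin n × Fin w → Fin w × Fin n → K) :
    ∑ b, ∑ c, F b c * matMulTensor K n w n a b c = ∑ m, F (a.1, m) (m, a.2) := by
  have h1 : ∀ b : Fin n × Fin w, ∑ c, F b c * matMulTensor K n w n a b c =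
      if b.1 = a.1 then F b (b.2, a.2) else 0 := by
    intro b
    by_cases hb : b.1 = a.1
    · rw [if_pos hb, Fintype.sum_eq_single (b.2, a.2)]
      · simp [matMulTensor, hb]
      · intro c hc
        have : ¬ (a.1 = b.1 ∧ b.2 = c.1 ∧ a.2 = c.2) := by
          rintro ⟨-, h2, h3⟩
          exact hc (Prod.ext h2.symm h3.symm)
        simp [matMulTensor, this]
    · rw [if_neg hb]
      refine Finset.sum_eq_zero fun c _ => ?_
      have : ¬ (a.1 = b.1 ∧ b.2 = c.1 ∧ a.2 = c.2) := fun h => hb h.1.symm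
      simp [matMulTensor, this]
  simp_rw [h1]
  rw [Fintype.sum_prod_type]
  simp only
  rw [Fintype.sum_eq_single a.1 (fun x hx => by simp [hx])]
  simp

/-- **The `GL(U) × GL(V)`-symmetry of `⟨n,w,n⟩`** in the `restrict` format: for matrices with
`P̂ Q̂ᵀ = 1` (on the row index `κ`) and `P̌ Řᵀ = 1` (on the column index `ν`),
`((P̂ ⊗ P̌) ⊗ (Q̂ ⊗ 1) ⊗ (1 ⊗ Ř)) ⟨n,w,n⟩ = ⟨n,w,n⟩` (`X ↦ P̂X`, `Z ↦ Z` …: the standard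
invariance `tr((PXQ⁻¹)(QY)(ZP⁻¹)) = tr(XYZ)`). [cite: LandsbergMichalek2018, §3 Part 1 ("The group GL(U) × GL(V) × GL(W) stabilizes M")] -/
theorem matMulTensor_stabilizer (n w : ℕ) (P Pc Q R : Fin n → Fin n → K)
    (hPQ : ∀ i j, ∑ k, P i k * Q j k = if i = j then 1 else 0)
    (hPR : ∀ i j, ∑ k, Pc i k * R j k = if i = j then 1 else 0)
    (a' : Fin n × Fin n) (b' : Fin n × Fin w) (c' : Fin w × Fin n) :
    ∑ a : Fin n × Fin n, ∑ b : Fin n × Fin w, ∑ c : Fin w × Fin n,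
      (P a'.1 a.1 * Pc a'.2 a.2) * (if b'.2 = b.2 then Q b'.1 b.1 else 0) *
        (if c'.1 = c.1 then R c'.2 c.2 else 0) * matMulTensor K n w n a b c =
      matMulTensor K n w n a' b' c' := by
  have inner : ∀ a : Fin n × Fin n, ∑ b : Fin n × Fin w, ∑ c : Fin w × Fin n,
      (P a'.1 a.1 * Pc a'.2 a.2) * (if b'.2 = b.2 then Q b'.1 b.1 else 0) *
        (if c'.1 = c.1 then R c'.2 c.2 else 0) * matMulTensor K n w n a b c =
      if b'.2 = c'.1 then (P a'.1 a.1 * Q b'.1 a.1) * (Pc a'.2 a.2 * R c'.2 a.2) else 0 := by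
    intro a
    rw [sum_sum_mul_matMulTensor K n w a (fun b c => (P a'.1 a.1 * Pc a'.2 a.2) *
      (if b'.2 = b.2 then Q b'.1 b.1 else 0) * (if c'.1 = c.1 then R c'.2 c.2 else 0))]
    simp only
    by_cases hbc : b'.2 = c'.1
    · rw [if_pos hbc, Fintype.sum_eq_single c'.1 (fun m hm => by rw [if_neg (Ne.symm hm)]; ring)]
      rw [if_pos hbc, if_pos rfl]
      ring
    · rw [if_neg hbc]
      refine Finset.sum_eq_zero fun m _ => ?_
      by_cases h1 : b'.2 = m
      · have h2 : c'.1 ≠ m := fun h2 => hbc (h1.trans h2.symm)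
        rw [if_neg h2]
        ring
      · rw [if_neg h1]
        ring
  simp_rw [inner]
  by_cases hbc : b'.2 = c'.1
  · simp only [if_pos hbc]
    rw [Fintype.sum_prod_type]
    simp only
    simp_rw [← Finset.mul_sum, ← Finset.sum_mul]
    rw [hPQ, hPR]
    obtain ⟨a₁, a₂⟩ := a'
    obtain ⟨b₁, b₂⟩ := b'
    obtain ⟨c₁, c₂⟩ := c'
    simp only at hbc ⊢
    subst hbc
    by_cases h1 : a₁ = b₁ <;> by_cases h2 : a₂ = c₂ <;> simp [matMulTensor, h1, h2]
  · simp only [if_neg hbc, Finset.sum_const_zero]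
    have : ¬ (a'.1 = b'.1 ∧ b'.2 = c'.1 ∧ a'.2 = c'.2) := fun h => hbc h.2.1
    simp [matMulTensor, this]

/-- The unipotent elementary matrix `1 + g·E_{yx}` (`g = 1` if `x ≠ y`, else `0`):
`e_x ↦ e_x + e_y`. [cite: LandsbergMichalek2018, §3 Part 1 ("using the Borel action we can move the entry")] -/
def moveMatrix (n : ℕ) (x y : Fin n) : Matrix (Fin n) (Fin n) K :=
  1 + Matrix.single y x (if x = y then 0 else 1)

/-- Its contragredient partner `1 − g·E_{yx}` (so that `moveMatrix · (moveInvT)ᵀ… `: see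
`moveMatrix_mul_moveInvT`). [cite: LandsbergMichalek2018, §3 Part 1] -/
def moveInvT (n : ℕ) (x y : Fin n) : Matrix (Fin n) (Fin n) K :=
  1 - Matrix.single y x (if x = y then 0 else 1)

/-- `(1 + gE_{yx})(1 − gE_{yx}) = 1` (`E_{yx}² = 0` for `x ≠ y`, `g = 0` for `x = y`).
[cite: LandsbergMichalek2018, §3 Part 1] -/
theorem moveMatrix_mul_moveInvT (n : ℕ) (x y : Fin n) :
    moveMatrix K n x y * moveInvT K n x y = 1 := by
  unfold moveMatrix moveInvT
  by_cases hxy : x = y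
  · simp [hxy]
  · rw [if_neg hxy]
    have h0 : Matrix.single y x (1 : K) * Matrix.single y x (1 : K) = 0 :=
      Matrix.single_mul_single_of_ne (1 : K) y x y hxy 1
    rw [add_mul, mul_sub, mul_sub, one_mul, one_mul, mul_one, h0, sub_zero]
    abel

/-- Entries of `moveMatrix`: `(1 + gE_{yx})_{ik} = [i = k] + g [i = y][k = x]`.
[cite: LandsbergMichalek2018, §3 Part 1] -/
theorem moveMatrix_apply (n : ℕ) (x y i k : Fin n) :
    moveMatrix K n x y i k =
      (if i = k then 1 else 0) + (if y = i ∧ x = k then (if x = y then 0 else 1) else 0) := by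
  simp [moveMatrix, Matrix.one_apply, Matrix.single_apply]

/-- The row identity `∑_k (1 + gE_{yx})_{ik} (1 − gE_{yx})_{jk} = [i = j]`, i.e.
`P̂ Q̂ᵀ = 1` with `Q̂ = (1 − gE_{yx})ᵀ = 1 − gE_{xy}`. [cite: LandsbergMichalek2018, §3 Part 1] -/
theorem sum_moveMatrix_mul_moveInvT (n : ℕ) (x y i j : Fin n) :
    ∑ k, moveMatrix K n x y i k * moveInvT K n x y k j = if i = j then 1 else 0 := by
  have h := congrFun (congrFun (moveMatrix_mul_moveInvT K n x y) i) j
  rw [Matrix.mul_apply, Matrix.one_apply] at h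
  exact h

/-- Support of `moveMatrix`: a non-zero entry `(i, k)` has `i = k` or `(i, k) = (y, x)` with
`x ≠ y`. [cite: LandsbergMichalek2018, §3 Part 1] -/
theorem moveMatrix_ne_zero {n : ℕ} {x y i k : Fin n} (h : moveMatrix K n x y i k ≠ 0) :
    i = k ∨ (i = y ∧ k = x ∧ x ≠ y) := by
  rw [moveMatrix_apply] at h
  by_cases hik : i = k
  · exact Or.inl hik
  · right
    rw [if_neg hik, zero_add] at h
    by_cases hyx : y = i ∧ x = k
    · rw [if_pos hyx] at h
      by_cases hxy : x = y
      · rw [if_pos hxy] at h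
        exact absurd rfl h
      · exact ⟨hyx.1.symm, hyx.2.symm, hxy⟩
    · rw [if_neg hyx] at h
      exact absurd rfl h

/-- `moveMatrix x y` sends `e_x` to `e_x + e_y`: its `(y, x)` entry is `1` (also when `x = y`).
[cite: LandsbergMichalek2018, §3 Part 1] -/
theorem moveMatrix_apply_target {n : ℕ} (x y : Fin n) : moveMatrix K n x y y x = 1 := by
  rw [moveMatrix_apply]
  by_cases hxy : x = y
  · subst hxy
    simp
  · rw [if_neg (Ne.symm hxy), if_pos ⟨rfl, rfl⟩, if_neg hxy, zero_add]

end Symmetry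

/-! ## Weights -/

section Weights

/-- The weight `ω(κ, ν) = (n − 1 − κ)·n + ν` of the cell `(κ, ν)`: strictly decreasing towards
the corner `(n − 1, 0)` in the lexicographic sense. [cite: LandsbergMichalek2018, §3 Part 1 ("By the torus action")] -/
theorem cellWeight_lt_iff (n : ℕ) (c c' : Fin n × Fin n) :
    (n - 1 - (c.1 : ℕ)) * n + c.2 < (n - 1 - (c'.1 : ℕ)) * n + c'.2 ↔
      (c'.1 : ℕ) < c.1 ∨ ((c.1 : ℕ) = c'.1 ∧ (c.2 : ℕ) < c'.2) := by
  have h1 : (c.1 : ℕ) < n := c.1.2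
  have h2 : (c'.1 : ℕ) < n := c'.1.2
  have h3 : (c.2 : ℕ) < n := c.2.2
  have h4 : (c'.2 : ℕ) < n := c'.2.2
  set X := n - 1 - (c.1 : ℕ) with hX
  set X' := n - 1 - (c'.1 : ℕ) with hX'
  constructor
  · intro h
    rcases lt_trichotomy X X' with hlt | heq | hgt
    · left; omega
    · right
      rw [heq] at h
      constructor <;> omega
    · exfalso
      have : (X' + 1) * n ≤ X * n := Nat.mul_le_mul_right n hgt
      have e : (X' + 1) * n = X' * n + n := by ring
      omega
  · rintro (h | ⟨h, h'⟩)
    · have hlt : X + 1 ≤ X' := by omega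
      have : (X + 1) * n ≤ X' * n := Nat.mul_le_mul_right n hlt
      have e : (X + 1) * n = X * n + n := by ring
      omega
    · have : X = X' := by omega
      rw [this]
      omega

/-- The weight is injective on cells. [cite: LandsbergMichalek2018, §3 Part 1] -/
theorem cellWeight_injective (n : ℕ) (c c' : Fin n × Fin n)
    (h : (n - 1 - (c.1 : ℕ)) * n + c.2 = (n - 1 - (c'.1 : ℕ)) * n + c'.2) : c = c' := by
  by_contra hne
  have key : (c'.1 : ℕ) < c.1 ∨ ((c.1 : ℕ) = c'.1 ∧ (c.2 : ℕ) < c'.2) ∨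
      (c.1 : ℕ) < c'.1 ∨ ((c'.1 : ℕ) = c.1 ∧ (c'.2 : ℕ) < c.2) := by
    by_cases h1 : (c.1 : ℕ) = c'.1
    · have h2 : (c.2 : ℕ) ≠ c'.2 := by
        intro h2
        exact hne (Prod.ext (Fin.ext h1) (Fin.ext h2))
      rcases Nat.lt_or_gt_of_ne h2 with hl | hl
      · exact Or.inr (Or.inl ⟨h1, hl⟩)
      · exact Or.inr (Or.inr (Or.inr ⟨h1.symm, hl⟩))
    · rcases Nat.lt_or_gt_of_ne h1 with hl | hl
      · exact Or.inr (Or.inr (Or.inl hl))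
      · exact Or.inl hl
  rcases key with hk | hk | hk | hk
  · have := (cellWeight_lt_iff n c c').2 (Or.inl hk); omega
  · have := (cellWeight_lt_iff n c c').2 (Or.inr hk); omega
  · have := (cellWeight_lt_iff n c' c).2 (Or.inl hk); omega
  · have := (cellWeight_lt_iff n c' c).2 (Or.inr hk); omega

end Weights

/-! ## The inductive step of Part 1 -/

section Step

variable (K)

/-- **Landsberg–Michałek 2018, §3 Part 1 — the inductive step, for the algebraic border rank.**
Let `λ'` be a Young diagram of cells (closed towards the corner `(n−1, 0)`) with `|λ'| < n²`, and
`w ≥ 1`.  Then there is a cell `β ∉ λ'` such that `λ' ∪ {β}` is again a Young diagram and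
`bR(⟨n,w,n⟩^{λ' ∪ {β}}) + 1 ≤ bR(⟨n,w,n⟩^{λ'})` (`t^λ` = `t` with the first-factor slices in `λ`
zeroed = `M/U_λ`).  Proof as printed ("by Proposition 2.3 there exists `a` … such that when we
reduce by it the border rank drops … By the torus action and Lemma 2.2 we may assume that `a` has
just one nonzero entry outside of `λ`. Further, using the Borel action we can move the entry
south-west to obtain the desired Young diagram"), with the group elements explicit: `a = lc`, the
leading coefficient vector of a non-zero first vector of an optimal decomposition; `α` its cell of
least weight `(n−1−κ)n + ν`; `β` an addable cell south-west of `α`; the unipotent element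
`(1 + E_{β₁α₁}) ⊗ (1 + E_{β₂α₂})` of `GL(U) × GL(V)` (with its contragredient on the other
factors) preserves `U_{λ'}` and `⟨n,w,n⟩`, and `β` is the strict weight-minimum of the support of
the moved vector; conclude by `algBorderRank_zeroSlice_le`. [cite: LandsbergMichalek2018, §3 Part 1] -/
theorem matMul_zeroSlices_step (n w : ℕ) (hw : 1 ≤ w) (S : Finset (Fin n × Fin n))
    (hS : ∀ b ∈ S, ∀ a : Fin n × Fin n, b.1 ≤ a.1 → a.2 ≤ b.2 → a ∈ S)
    (hcard : S.card < n * n) :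
    ∃ β : Fin n × Fin n, β ∉ S ∧
      (∀ b ∈ insert β S, ∀ a : Fin n × Fin n, b.1 ≤ a.1 → a.2 ≤ b.2 → a ∈ insert β S) ∧
      algBorderRank (zeroSlices (insert β S) (matMulTensor K n w n)) + 1 ≤
        algBorderRank (zeroSlices S (matMulTensor K n w n)) := by
  classical
  -- a cell outside `S`, at which `t = ⟨n,w,n⟩^S` has a non-zero entry
  obtain ⟨γ, hγ⟩ : ∃ γ : Fin n × Fin n, γ ∉ S := by
    by_contra hno
    push Not at hno
    have hu : S = Finset.univ := Finset.eq_univ_iff_forall.2 hno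
    rw [hu, Finset.card_univ, Fintype.card_prod, Fintype.card_fin] at hcard
    exact lt_irrefl _ hcard
  set μ₀ : Fin w := ⟨0, hw⟩ with hμ₀
  have htne : zeroSlices S (matMulTensor K n w n) γ (γ.1, μ₀) (μ₀, γ.2) = 1 := by
    simp [zeroSlices_apply, hγ, matMulTensor]
  -- an optimal approximate decomposition, with `r + 1` triads
  obtain ⟨h, hh⟩ := exists_algBorderRank_eq_approxRank (zeroSlices S (matMulTensor K n w n))
  obtain ⟨r₁, hr₁⟩ : ∃ r₁, algBorderRank (zeroSlices S (matMulTensor K n w n)) = r₁ := ⟨_, rfl⟩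
  have hA : approxRank h (zeroSlices S (matMulTensor K n w n)) = r₁ := by rw [← hh, hr₁]
  cases r₁ with
  | zero =>
    exfalso
    obtain ⟨u, v, w', huvw⟩ : ∃ (u : Fin 0 → Fin n × Fin n → K[X])
        (v : Fin 0 → Fin n × Fin w → K[X]) (w' : Fin 0 → Fin w × Fin n → K[X]),
        IsApproxDecomposition h (zeroSlices S (matMulTensor K n w n)) u v w' := by
      rw [← hA]
      exact exists_isApproxDecomposition_approxRank h _
    have key := huvw γ (γ.1, μ₀) (μ₀, γ.2) h le_rfl
    rw [if_pos rfl, htne] at key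
    simp at key
  | succ r =>
    obtain ⟨u, v, w', huvw⟩ : ∃ (u : Fin (r + 1) → Fin n × Fin n → K[X])
        (v : Fin (r + 1) → Fin n × Fin w → K[X]) (w' : Fin (r + 1) → Fin w × Fin n → K[X]),
        IsApproxDecomposition h (zeroSlices S (matMulTensor K n w n)) u v w' := by
      rw [← hA]
      exact exists_isApproxDecomposition_approxRank h _
    -- zero the `S`-coordinates of the first vectors
    have D0 := huvw.zeroOn
    set u₀ : Fin (r + 1) → Fin n × Fin n → K[X] := fun ρ a => if a ∈ S then 0 else u ρ a with hu₀
    -- some first vector is non-zero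
    obtain ⟨ρ₀, hρ₀⟩ : ∃ ρ₀, u₀ ρ₀ ≠ 0 := by
      by_contra hno
      push Not at hno
      have key := D0 γ (γ.1, μ₀) (μ₀, γ.2) h le_rfl
      rw [if_pos rfl, htne] at key
      have h0 : (∑ ρ, u₀ ρ γ * v ρ (γ.1, μ₀) * w' ρ (μ₀, γ.2)) = 0 :=
        Finset.sum_eq_zero fun ρ _ => by rw [hno ρ]; simp
      change (∑ ρ, u₀ ρ γ * v ρ (γ.1, μ₀) * w' ρ (μ₀, γ.2)).coeff h = 1 at key
      rw [h0, coeff_zero] at key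
      exact zero_ne_one key
    -- leading data `u₀ ρ₀ = ε^s (lc + ε R)`, `lc ≠ 0`, `lc = 0` on `S`
    obtain ⟨s, lc, R, hlead, hlc⟩ := exists_leadingData (u₀ ρ₀) hρ₀
    have hlcS : ∀ a ∈ S, lc a = 0 := by
      intro a ha
      have h1 : u₀ ρ₀ a = 0 := by simp [hu₀, ha]
      have h2 := hlead a
      rw [h1] at h2
      have h3 : C (lc a) + X * R a = 0 :=
        (mul_eq_zero.1 h2.symm).resolve_left (pow_ne_zero _ X_ne_zero)
      have h4 := congrArg (fun q : K[X] => q.coeff 0) h3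
      simpa using h4
    -- `α`: the cell of least weight in the support of `lc`
    have hsupp : (Finset.univ.filter fun a => lc a ≠ 0).Nonempty := by
      by_contra h0
      rw [Finset.not_nonempty_iff_eq_empty, Finset.filter_eq_empty_iff] at h0
      exact hlc (funext fun a => by simpa using h0 (Finset.mem_univ a))
    obtain ⟨α, hα, hαmin⟩ := Finset.exists_min_image _
      (fun c : Fin n × Fin n => (n - 1 - (c.1 : ℕ)) * n + c.2) hsupp
    rw [Finset.mem_filter] at hα
    have hαS : α ∉ S := fun hmem => hα.2 (hlcS α hmem)
    have hαlt : ∀ a, lc a ≠ 0 → a ≠ α →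
        (a.1 : ℕ) < α.1 ∨ ((α.1 : ℕ) = a.1 ∧ (α.2 : ℕ) < a.2) := by
      intro a ha hne
      have hle := hαmin a (by simpa using ha)
      rcases Nat.lt_or_eq_of_le hle with hlt | heq
      · exact (cellWeight_lt_iff n α a).1 hlt
      · exact absurd (cellWeight_injective n α a heq).symm hne
    -- `β`: an addable cell south-west of `α`
    set SW := Finset.univ.filter fun c : Fin n × Fin n => c ∉ S ∧ α.1 ≤ c.1 ∧ c.2 ≤ α.2
      with hSW
    have hSWne : SW.Nonempty := ⟨α, by simp [hSW, hαS]⟩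
    obtain ⟨β, hβSW, hβmin⟩ :=
      Finset.exists_min_image SW (fun c : Fin n × Fin n => (n - 1 - (c.1 : ℕ)) + c.2) hSWne
    have hβSW' : β ∉ S ∧ α.1 ≤ β.1 ∧ β.2 ≤ α.2 := by
      simpa [hSW] using hβSW
    obtain ⟨hβS, hβ1, hβ2⟩ := hβSW'
    have hβ1' : (α.1 : ℕ) ≤ β.1 := hβ1
    have hβ2' : (β.2 : ℕ) ≤ α.2 := hβ2
    -- `insert β S` is a Young diagram
    have hins : ∀ b ∈ insert β S, ∀ a : Fin n × Fin n, b.1 ≤ a.1 → a.2 ≤ b.2 →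
        a ∈ insert β S := by
      intro b hb a h1 h2
      have h1' : (b.1 : ℕ) ≤ a.1 := h1
      have h2' : (a.2 : ℕ) ≤ b.2 := h2
      rw [Finset.mem_insert] at hb ⊢
      rcases hb with rfl | hb
      · by_cases hab : a = b
        · exact Or.inl hab
        · right
          by_contra haS
          have haSW : a ∈ SW := by
            simp only [hSW, Finset.mem_filter, Finset.mem_univ, true_and]
            exact ⟨haS, hβ1.trans h1, h2.trans hβ2⟩
          have hle := hβmin a haSW
          have hne' : (a.1 : ℕ) ≠ b.1 ∨ (a.2 : ℕ) ≠ b.2 := by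
            by_contra hh
            push Not at hh
            exact hab (Prod.ext (Fin.ext hh.1) (Fin.ext hh.2))
          have ha1 := a.1.2
          have hb1 := b.1.2
          rcases hne' with hne' | hne' <;> omega
      · exact Or.inr (hS b hb a h1 h2)
    refine ⟨β, hβS, hins, ?_⟩
    -- the move `α → β`: `P̂ = 1 + E_{β₁α₁}` on `κ`, `P̌ = 1 + E_{β₂α₂}` on `ν`
    set P : Fin n → Fin n → K := fun i k => moveMatrix K n α.1 β.1 i k with hP
    set Pc : Fin n → Fin n → K := fun i k => moveMatrix K n α.2 β.2 i k with hPc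
    set Q : Fin n → Fin n → K := fun j k => moveInvT K n α.1 β.1 k j with hQ
    set Rm : Fin n → Fin n → K := fun j k => moveInvT K n α.2 β.2 k j with hRm
    have hPQ : ∀ i j, ∑ k, P i k * Q j k = if i = j then 1 else 0 := fun i j =>
      sum_moveMatrix_mul_moveInvT K n α.1 β.1 i j
    have hPR : ∀ i j, ∑ k, Pc i k * Rm j k = if i = j then 1 else 0 := fun i j =>
      sum_moveMatrix_mul_moveInvT K n α.2 β.2 i j
    set A : Fin n × Fin n → Fin n × Fin n → K := fun a' a => P a'.1 a.1 * Pc a'.2 a.2 with hAdef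
    set B : Fin n × Fin w → Fin n × Fin w → K :=
      fun b' b => if b'.2 = b.2 then Q b'.1 b.1 else 0 with hBdef
    set Cm : Fin w × Fin n → Fin w × Fin n → K :=
      fun c' c => if c'.1 = c.1 then Rm c'.2 c.2 else 0 with hCdef
    have hstab0 : ∀ a' b' c', ∑ a, ∑ b, ∑ c, A a' a * B b' b * Cm c' c *
        matMulTensor K n w n a b c = matMulTensor K n w n a' b' c' :=
      matMulTensor_stabilizer K n w P Pc Q Rm hPQ hPR
    -- `A` moves cells south-west only, hence preserves `U_S`
    have hAsw : ∀ a' a, A a' a ≠ 0 → ((a.1 : ℕ) ≤ a'.1 ∧ (a'.2 : ℕ) ≤ a.2) ∧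
        ((a'.1 = a.1 ∨ (a'.1 = β.1 ∧ a.1 = α.1 ∧ α.1 ≠ β.1)) ∧
         (a'.2 = a.2 ∨ (a'.2 = β.2 ∧ a.2 = α.2 ∧ α.2 ≠ β.2))) := by
      intro a' a hne
      have hP1 : moveMatrix K n α.1 β.1 a'.1 a.1 ≠ 0 := left_ne_zero_of_mul hne
      have hP2 : moveMatrix K n α.2 β.2 a'.2 a.2 ≠ 0 := right_ne_zero_of_mul hne
      have k1 := moveMatrix_ne_zero K hP1
      have k2 := moveMatrix_ne_zero K hP2
      refine ⟨⟨?_, ?_⟩, k1, k2⟩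
      · rcases k1 with e | ⟨e1, e2, -⟩
        · exact le_of_eq (congrArg Fin.val e).symm
        · rw [e1, e2]; exact hβ1'
      · rcases k2 with e | ⟨e1, e2, -⟩
        · exact le_of_eq (congrArg Fin.val e)
        · rw [e1, e2]; exact hβ2'
    have hAS : ∀ a' a, a ∈ S → a' ∉ S → A a' a = 0 := by
      intro a' a ha ha'
      by_contra hne
      obtain ⟨⟨h1, h2⟩, -⟩ := hAsw a' a hne
      exact ha' (hS a ha a' h1 h2)
    have hstab := zeroSlices_stabilizer S (matMulTensor K n w n) A B Cm hstab0 hAS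
    -- weights: `t` is homogeneous
    set ωA : Fin n × Fin n → ℕ := fun c => (n - 1 - (c.1 : ℕ)) * n + c.2 with hωA
    set ωB : Fin n × Fin w → ℕ := fun b => (b.1 : ℕ) * n with hωB
    set ωC : Fin w × Fin n → ℕ := fun c => n - 1 - (c.2 : ℕ) with hωC
    have hhom : ∀ a b c, zeroSlices S (matMulTensor K n w n) a b c ≠ 0 →
        ωA a + ωB b + ωC c = (n - 1) * n + (n - 1) := by
      intro a b c hne
      have h0 : matMulTensor K n w n a b c ≠ 0 := by
        intro h0
        apply hne
        simp [zeroSlices_apply, h0]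
      have hsupp : a.1 = b.1 ∧ b.2 = c.1 ∧ a.2 = c.2 := by
        by_contra hc
        exact h0 (by simp [matMulTensor, hc])
      obtain ⟨e1, -, e3⟩ := hsupp
      simp only [hωA, hωB, hωC]
      rw [← e1, ← e3]
      have ha1 := a.1.2
      have ha2 := a.2.2
      set X1 := n - 1 - (a.1 : ℕ) with hX1
      set Y1 := n - 1 - (a.2 : ℕ) with hY1
      have hX' : X1 + a.1 = n - 1 := by omega
      have hY' : (a.2 : ℕ) + Y1 = n - 1 := by omega
      calc X1 * n + a.2 + a.1 * n + Y1 = (X1 + a.1) * n + (a.2 + Y1) := by ring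
        _ = (n - 1) * n + (n - 1) := by rw [hX', hY']
    -- `β` is the strict weight-minimum of the support of `Ā · lc`
    set Abar : Fin n × Fin n → Fin n × Fin n → K :=
      fun a' a => if a' ∈ S ∨ a ∈ S then 0 else A a' a with hAbar
    have hAβα : A β α = 1 := by
      simp only [hAdef, hP, hPc, moveMatrix_apply_target, mul_one]
    have hAβ : ∀ a, Abar β a * lc a = if a = α then lc α else 0 := by
      intro a
      by_cases haS : a ∈ S
      · have : a ≠ α := fun h => hαS (h ▸ haS)
        rw [if_neg this, hlcS a haS, mul_zero]
      · have hAb : Abar β a = A β a := by simp [hAbar, hβS, haS]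
        rw [hAb]
        by_cases haα : a = α
        · subst haα
          rw [if_pos rfl, hAβα, one_mul]
        · rw [if_neg haα]
          by_cases hla : lc a = 0
          · rw [hla, mul_zero]
          · have hw' := hαlt a hla haα
            by_cases hAz : A β a = 0
            · rw [hAz, zero_mul]
            · exfalso
              obtain ⟨⟨h1, h2⟩, k1, k2⟩ := hAsw β a hAz
              have e1 : (a.1 : ℕ) = β.1 ∨ (a.1 : ℕ) = α.1 := by
                rcases k1 with e | ⟨-, e, -⟩
                · exact Or.inl (congrArg Fin.val e).symm
                · exact Or.inr (congrArg Fin.val e)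
              have e2 : (a.2 : ℕ) = β.2 ∨ (a.2 : ℕ) = α.2 := by
                rcases k2 with e | ⟨-, e, -⟩
                · exact Or.inl (congrArg Fin.val e).symm
                · exact Or.inr (congrArg Fin.val e)
              rcases hw' with hw' | ⟨hw1, hw2⟩ <;> rcases e1 with e1 | e1 <;>
                rcases e2 with e2 | e2 <;> omega
    have hβsum : ∑ a, Abar β a * lc a = lc α := by
      simp_rw [hAβ]
      simp
    have hβne : ∑ a, Abar β a * lc a ≠ 0 := by rw [hβsum]; exact hα.2
    have hmin : ∀ a', a' ≠ β → ∑ a, Abar a' a * lc a ≠ 0 → ωA β < ωA a' := by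
      intro a' hne hsum
      obtain ⟨a, -, hterm⟩ := Finset.exists_ne_zero_of_sum_ne_zero hsum
      have hAa : Abar a' a ≠ 0 := left_ne_zero_of_mul hterm
      have hla : lc a ≠ 0 := right_ne_zero_of_mul hterm
      have haS : a ∉ S := fun h => hla (hlcS a h)
      have ha'S : a' ∉ S := by
        intro h
        apply hAa
        simp [hAbar, h]
      have hAa' : A a' a ≠ 0 := by
        simpa [hAbar, haS, ha'S] using hAa
      obtain ⟨⟨h1, h2⟩, k1, k2⟩ := hAsw a' a hAa'
      rw [cellWeight_lt_iff]
      -- coordinates as natural numbers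
      have hne' : (a'.1 : ℕ) ≠ β.1 ∨ (a'.2 : ℕ) ≠ β.2 := by
        by_contra hh
        push Not at hh
        exact hne (Prod.ext (Fin.ext hh.1) (Fin.ext hh.2))
      have e1 : (a'.1 : ℕ) = a.1 ∨ ((a'.1 : ℕ) = β.1 ∧ (a.1 : ℕ) = α.1 ∧ (α.1 : ℕ) ≠ β.1) := by
        rcases k1 with e | ⟨f1, f2, f3⟩
        · exact Or.inl (congrArg Fin.val e)
        · exact Or.inr ⟨congrArg Fin.val f1, congrArg Fin.val f2,
            fun h => f3 (Fin.ext h)⟩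
      have e2 : (a'.2 : ℕ) = a.2 ∨ ((a'.2 : ℕ) = β.2 ∧ (a.2 : ℕ) = α.2 ∧ (α.2 : ℕ) ≠ β.2) := by
        rcases k2 with e | ⟨f1, f2, f3⟩
        · exact Or.inl (congrArg Fin.val e)
        · exact Or.inr ⟨congrArg Fin.val f1, congrArg Fin.val f2,
            fun h => f3 (Fin.ext h)⟩
      have hwa : a = α ∨ (a.1 : ℕ) < α.1 ∨ ((α.1 : ℕ) = a.1 ∧ (α.2 : ℕ) < a.2) := by
        by_cases haα : a = α
        · exact Or.inl haα
        · exact Or.inr (hαlt a hla haα)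
      rcases hwa with rfl | hwa | ⟨hw1, hw2⟩
      · rcases e1 with e1 | ⟨e1, -, -⟩ <;> rcases e2 with e2 | ⟨e2, -, -⟩ <;>
          rcases hne' with hne' | hne' <;> omega
      · rcases e1 with e1 | ⟨e1, f2, f3⟩ <;> rcases e2 with e2 | ⟨e2, -, -⟩ <;> omega
      · rcases e1 with e1 | ⟨e1, f2, f3⟩ <;> rcases e2 with e2 | ⟨e2, g2, g3⟩ <;> omega
    -- conclude by the generic step
    have key := algBorderRank_zeroSlice_le D0 ρ₀ s lc R hlead Abar B Cm hstab ωA ωB ωC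
      ((n - 1) * n + (n - 1)) hhom β hβne hmin
    rw [zeroSlice_zeroSlices] at key
    rw [hr₁]
    omega

/-- **Landsberg–Michałek 2018, §3 Part 1, for the algebraic border rank.** For `w ≥ 1` and every
`k ≤ n²` there is a Young diagram `λ` with `k` cells (closed towards the corner `(n−1, 0)`) such
that `bR(⟨n,w,n⟩^λ) + k ≤ bR(⟨n,w,n⟩)` ("we prove by induction on `k` that for any `k < n` there
exists a Young diagram `λ` with `k` boxes such that `R̲(M^λ_{⟨n,n,w⟩}) ≤ R̲(M_{⟨n,n,w⟩}) − k`";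
the induction runs as long as a cell is left). [cite: LandsbergMichalek2018, §3 Part 1] -/
theorem matMul_exists_youngDiagram_algBorderRank_le (n w : ℕ) (hw : 1 ≤ w) (k : ℕ)
    (hk : k ≤ n * n) :
    ∃ S : Finset (Fin n × Fin n), S.card = k ∧
      (∀ b ∈ S, ∀ a : Fin n × Fin n, b.1 ≤ a.1 → a.2 ≤ b.2 → a ∈ S) ∧
      algBorderRank (zeroSlices S (matMulTensor K n w n)) + k ≤
        algBorderRank (matMulTensor K n w n) := by
  induction k with
  | zero =>
    refine ⟨∅, Finset.card_empty, fun b hb => absurd hb (Finset.notMem_empty b), ?_⟩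
    rw [zeroSlices_empty, add_zero]
  | succ k ih =>
    obtain ⟨S, hScard, hS, hSle⟩ := ih (Nat.le_of_succ_le hk)
    obtain ⟨β, hβS, hins, hstep⟩ :=
      matMul_zeroSlices_step K n w hw S hS (by rw [hScard]; omega)
    refine ⟨insert β S, by rw [Finset.card_insert_of_notMem hβS, hScard], hins, ?_⟩
    omega

end Step

end Literature.Computability.AlgebraicComplexity

end
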